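import Summits.ValiantsHypothesis.ValiantsHypothesis.Theses.BorderApolarity
import Summits.ValiantsHypothesis.ValiantsHypothesis.Theorems.BorderApolarityToricFixedPointsToricLimitIsInitialAux1

/-!
# `ToricFixedPoints` / line `form_then_lift`, stub F1 at `(n,m) = (3,3)`: the `H₀(3,3)` hypothesis
forces COMMON MARGINS (content class) on the support of `F`

At `(3,3)` the route's `H₀`-block in F1 (`stub_formDebordering`, hypothesis (4)) consists of the
invertible matrices `M` with every column diagonal (condition (2) with `m - n = 0`), rank-one diagonal
`M_{(i,j)} = rᵢcⱼ` (condition (3)) and `∏ᵢ rᵢcᵢ = 1` (condition (4)); condition (1) is then empty.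
This file proves in the kernel the first step of Disproof.lean §6d ("the `T⁵`-weight cubics are the
6 content classes"): if a degree-`k` form `F` satisfies hypothesis (4) of F1 at `(3,3)` then any two
monomials in its support have the same row sums and the same column sums
(`h0_33_sameMargins`).  The proof feeds five explicit torus elements
(`rᵢ = 2`, `c₂ = 2⁻¹`; `cⱼ = 2`, `c₂ = 2⁻¹`) into the hypothesis and compares coefficients
(`tli_coeff_linSubst_diagonal`).  Together with `FormDeborderingEndType.lean` (End-type ⇒ toric) this
reduces F1 at (3,3) to the content classes listed in Disproof §6d; the only class not identically in
`End·det₃` is the permutation-monomial family `Σ_σ c_σ x_σ` (where `G₃ = (det₃+per₃)/2` lives and is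
not a border point by the LMR dual criterion, on paper).  Refuter/theory seat `val-width-5779-d1`
(stmt-ValiantsHypothesis-5779).  VP ≠ VNP is not touched.
-/

open MvPolynomial Finset
open Literature.Computability.AlgebraicComplexity
open Summit.ValiantsHypothesis.ValiantsHypothesis.Theorems.BorderApolarityToricFixedPoints
  (tli_coeff_linSubst_diagonal)

namespace Summit.ValiantsHypothesis.Cruxes.ToricFixedPoints.Negative

/-- Row sum `Rᵢ(d) = Σⱼ d(i,j)` of an exponent table. [folklore] -/
theorem sum_prod_type_rowSums (d : (Fin 3 × Fin 3) →₀ ℕ) :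
    ∑ x, d x = ∑ i : Fin 3, ∑ j : Fin 3, d (i, j) :=
  Fintype.sum_prod_type _

/-- The torus character of a monomial under `diag(rᵢcⱼ)` factors through the margins:
`∏ₓ (r_{x.1} c_{x.2})^{dₓ} = (∏ᵢ rᵢ^{Rᵢ(d)}) (∏ⱼ cⱼ^{Cⱼ(d)})`. [folklore] -/
theorem prod_support_rankOne_pow (r c : Fin 3 → ℂ) (d : (Fin 3 × Fin 3) →₀ ℕ) :
    ∏ x ∈ d.support, (r x.1 * c x.2) ^ d x =
      (∏ i : Fin 3, r i ^ ∑ j : Fin 3, d (i, j)) * ∏ j : Fin 3, c j ^ ∑ i : Fin 3, d (i, j) := by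
  rw [Finset.prod_subset (Finset.subset_univ d.support)
    (fun x _ hx => by rw [Finsupp.notMem_support_iff.1 hx, pow_zero])]
  simp only [mul_pow, Finset.prod_mul_distrib]
  congr 1
  · rw [Fintype.prod_prod_type]
    exact Finset.prod_congr rfl fun i _ => by simp only [Finset.prod_pow_eq_pow_sum]
  · rw [Fintype.prod_prod_type_right]
    exact Finset.prod_congr rfl fun j _ => by simp only [Finset.prod_pow_eq_pow_sum]

/-- `2^a (2⁻¹)^b = 2^{a'} (2⁻¹)^{b'}` in `ℂ` forces `a + b' = a' + b`. [folklore] -/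
theorem two_pow_mul_inv_pow_inj {a b a' b' : ℕ}
    (h : (2 : ℂ) ^ a * (2⁻¹ : ℂ) ^ b = (2 : ℂ) ^ a' * (2⁻¹ : ℂ) ^ b') : a + b' = a' + b := by
  have h2 : (2 : ℂ) ≠ 0 := two_ne_zero
  set q : ℂ := (2⁻¹ : ℂ) with hq
  have e1 : q ^ b * 2 ^ b = 1 := by rw [← mul_pow, hq, inv_mul_cancel₀ h2, one_pow]
  have e2 : q ^ b' * 2 ^ b' = 1 := by rw [← mul_pow, hq, inv_mul_cancel₀ h2, one_pow]
  have h' : (2 : ℂ) ^ (a + b') = (2 : ℂ) ^ (a' + b) := by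
    calc (2 : ℂ) ^ (a + b') = 2 ^ a * (q ^ b * 2 ^ b) * 2 ^ b' := by rw [e1, mul_one, pow_add]
      _ = 2 ^ a * q ^ b * 2 ^ b * 2 ^ b' := by ring
      _ = 2 ^ a' * q ^ b' * 2 ^ b * 2 ^ b' := by rw [h]
      _ = 2 ^ a' * 2 ^ b * (q ^ b' * 2 ^ b') := by ring
      _ = (2 : ℂ) ^ (a' + b) := by rw [e2, mul_one, pow_add]
  have h'' : ((2 ^ (a + b') : ℕ) : ℂ) = ((2 ^ (a' + b) : ℕ) : ℂ) := by push_cast; exact h'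
  exact Nat.pow_right_injective (le_refl 2) (Nat.cast_inj.1 h'')

/-- **One torus element.**  If `F` satisfies hypothesis (4) of `stub_formDebordering` at `(3,3)` and
`rᵢ, cⱼ ≠ 0` with `∏ᵢ rᵢcᵢ = 1`, then the character `(∏ᵢ rᵢ^{Rᵢ})(∏ⱼ cⱼ^{Cⱼ})` takes the same value
on any two monomials of the support of `F` (feed `M = diag(rᵢcⱼ)`, compare coefficients). [folklore] -/
theorem h0_33_character_eq {F : MvPolynomial (Fin 3 × Fin 3) ℂ}
    (hH : ∀ A : Matrix.GeneralLinearGroup (Fin 3 × Fin 3) ℂ,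
      let M : Matrix (Fin 3 × Fin 3) (Fin 3 × Fin 3) ℂ := A
      (∀ i j : Fin 3 × Fin 3, M j i ≠ 0 →
        (fun p : Fin 3 × Fin 3 =>
            (if (3 - 3 ≤ (p.1 : ℕ) ∧ 3 - 3 ≤ (p.2 : ℕ)) ∨ p = (0, 0) then 0 else 3 * 3) +
              ((p.1 : ℕ) * 3 + (p.2 : ℕ))) j ≤
        (fun p : Fin 3 × Fin 3 =>
            (if (3 - 3 ≤ (p.1 : ℕ) ∧ 3 - 3 ≤ (p.2 : ℕ)) ∨ p = (0, 0) then 0 else 3 * 3) +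
              ((p.1 : ℕ) * 3 + (p.2 : ℕ))) i) →
      (∀ i j : Fin 3 × Fin 3, ((3 - 3 ≤ (i.1 : ℕ) ∧ 3 - 3 ≤ (i.2 : ℕ)) ∨ i = (0, 0)) →
        j ≠ i → M j i = 0) →
      (∀ i k j l : Fin 3, 3 - 3 ≤ (i : ℕ) → 3 - 3 ≤ (k : ℕ) → 3 - 3 ≤ (j : ℕ) → 3 - 3 ≤ (l : ℕ) →
        M (i, j) (i, j) * M (k, l) (k, l) = M (i, l) (i, l) * M (k, j) (k, j)) →
      M (0, 0) (0, 0) ^ (3 - 3) * ∏ i ∈ Finset.univ.filter (fun i : Fin 3 => 3 - 3 ≤ (i : ℕ)),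
        M (i, i) (i, i) = 1 →
      ∃ e : ℂ, linSubst (Fin 3 × Fin 3) ℂ M F = e • F)
    (r c : Fin 3 → ℂ) (hr : ∀ i, r i ≠ 0) (hc : ∀ j, c j ≠ 0)
    (hrc : r 0 * c 0 * (r 1 * c 1) * (r 2 * c 2) = 1)
    {d d' : (Fin 3 × Fin 3) →₀ ℕ} (hd : d ∈ F.support) (hd' : d' ∈ F.support) :
    (∏ i : Fin 3, r i ^ ∑ j : Fin 3, d (i, j)) * ∏ j : Fin 3, c j ^ ∑ i : Fin 3, d (i, j) =
      (∏ i : Fin 3, r i ^ ∑ j : Fin 3, d' (i, j)) * ∏ j : Fin 3, c j ^ ∑ i : Fin 3, d' (i, j) := by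
  set v : Fin 3 × Fin 3 → ℂ := fun x => r x.1 * c x.2 with hv
  have hv0 : ∀ x, v x ≠ 0 := fun x => mul_ne_zero (hr x.1) (hc x.2)
  have hdet : (Matrix.diagonal v).det ≠ 0 := by
    rw [Matrix.det_diagonal]; exact Finset.prod_ne_zero_iff.2 fun x _ => hv0 x
  set A : Matrix.GeneralLinearGroup (Fin 3 × Fin 3) ℂ :=
    Matrix.GeneralLinearGroup.mkOfDetNeZero _ hdet with hAdef
  have hA : (A : Matrix (Fin 3 × Fin 3) (Fin 3 × Fin 3) ℂ) = Matrix.diagonal v := rfl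
  have c1 : ∀ i j : Fin 3 × Fin 3, (A : Matrix (Fin 3 × Fin 3) (Fin 3 × Fin 3) ℂ) j i ≠ 0 →
      (fun p : Fin 3 × Fin 3 =>
          (if (3 - 3 ≤ (p.1 : ℕ) ∧ 3 - 3 ≤ (p.2 : ℕ)) ∨ p = (0, 0) then 0 else 3 * 3) +
            ((p.1 : ℕ) * 3 + (p.2 : ℕ))) j ≤
      (fun p : Fin 3 × Fin 3 =>
          (if (3 - 3 ≤ (p.1 : ℕ) ∧ 3 - 3 ≤ (p.2 : ℕ)) ∨ p = (0, 0) then 0 else 3 * 3) +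
            ((p.1 : ℕ) * 3 + (p.2 : ℕ))) i := by
    intro i j h
    rw [hA] at h
    by_cases hji : j = i
    · rw [hji]
    · exact absurd (Matrix.diagonal_apply_ne v hji) h
  have c2 : ∀ i j : Fin 3 × Fin 3, ((3 - 3 ≤ (i.1 : ℕ) ∧ 3 - 3 ≤ (i.2 : ℕ)) ∨ i = (0, 0)) →
      j ≠ i → (A : Matrix (Fin 3 × Fin 3) (Fin 3 × Fin 3) ℂ) j i = 0 := by
    intro i j _ hji
    rw [hA]
    exact Matrix.diagonal_apply_ne v hji
  have c3 : ∀ i k j l : Fin 3, 3 - 3 ≤ (i : ℕ) → 3 - 3 ≤ (k : ℕ) → 3 - 3 ≤ (j : ℕ) →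
      3 - 3 ≤ (l : ℕ) →
      (A : Matrix (Fin 3 × Fin 3) (Fin 3 × Fin 3) ℂ) (i, j) (i, j) *
          (A : Matrix (Fin 3 × Fin 3) (Fin 3 × Fin 3) ℂ) (k, l) (k, l) =
        (A : Matrix (Fin 3 × Fin 3) (Fin 3 × Fin 3) ℂ) (i, l) (i, l) *
          (A : Matrix (Fin 3 × Fin 3) (Fin 3 × Fin 3) ℂ) (k, j) (k, j) := by
    intro i k j l _ _ _ _
    rw [hA]
    simp only [Matrix.diagonal_apply_eq, hv]
    ring
  have c4 : (A : Matrix (Fin 3 × Fin 3) (Fin 3 × Fin 3) ℂ) (0, 0) (0, 0) ^ (3 - 3) *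
      ∏ i ∈ Finset.univ.filter (fun i : Fin 3 => 3 - 3 ≤ (i : ℕ)),
        (A : Matrix (Fin 3 × Fin 3) (Fin 3 × Fin 3) ℂ) (i, i) (i, i) = 1 := by
    have hfilt : Finset.univ.filter (fun i : Fin 3 => 3 - 3 ≤ (i : ℕ)) = Finset.univ :=
      Finset.filter_true_of_mem fun i _ => Nat.zero_le _
    rw [hA, hfilt, Fin.prod_univ_three]
    simp only [Matrix.diagonal_apply_eq, hv, Nat.sub_self, pow_zero, one_mul]
    exact hrc
  obtain ⟨e, he⟩ := hH A c1 c2 c3 c4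
  rw [hA] at he
  have key : ∀ {δ : (Fin 3 × Fin 3) →₀ ℕ}, δ ∈ F.support → ∏ x ∈ δ.support, v x ^ δ x = e := by
    intro δ hδ
    have h1 := congr_arg (coeff δ) he
    rw [tli_coeff_linSubst_diagonal, coeff_smul, smul_eq_mul] at h1
    exact mul_right_cancel₀ (mem_support_iff.1 hδ) h1
  have hdd := (key hd).trans (key hd').symm
  rwa [hv, prod_support_rankOne_pow, prod_support_rankOne_pow] at hdd

/-- **`H₀(3,3)`-semi-invariance forces a content class.**  If a degree-`k` form `F` on the `3 × 3`
variables satisfies hypothesis (4) of `stub_formDebordering` at `(n,m) = (3,3)` (stated verbatim,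
with `m - n = 3 - 3`), then all monomials in its support have the same row sums and the same column
sums (Disproof.lean §6d, first sentence, now in the kernel). [folklore] -/
theorem h0_33_sameMargins {k : ℕ} {F : MvPolynomial (Fin 3 × Fin 3) ℂ} (hF : F.IsHomogeneous k)
    (hH : ∀ A : Matrix.GeneralLinearGroup (Fin 3 × Fin 3) ℂ,
      let M : Matrix (Fin 3 × Fin 3) (Fin 3 × Fin 3) ℂ := A
      (∀ i j : Fin 3 × Fin 3, M j i ≠ 0 →
        (fun p : Fin 3 × Fin 3 =>
            (if (3 - 3 ≤ (p.1 : ℕ) ∧ 3 - 3 ≤ (p.2 : ℕ)) ∨ p = (0, 0) then 0 else 3 * 3) +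
              ((p.1 : ℕ) * 3 + (p.2 : ℕ))) j ≤
        (fun p : Fin 3 × Fin 3 =>
            (if (3 - 3 ≤ (p.1 : ℕ) ∧ 3 - 3 ≤ (p.2 : ℕ)) ∨ p = (0, 0) then 0 else 3 * 3) +
              ((p.1 : ℕ) * 3 + (p.2 : ℕ))) i) →
      (∀ i j : Fin 3 × Fin 3, ((3 - 3 ≤ (i.1 : ℕ) ∧ 3 - 3 ≤ (i.2 : ℕ)) ∨ i = (0, 0)) →
        j ≠ i → M j i = 0) →
      (∀ i k j l : Fin 3, 3 - 3 ≤ (i : ℕ) → 3 - 3 ≤ (k : ℕ) → 3 - 3 ≤ (j : ℕ) → 3 - 3 ≤ (l : ℕ) →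
        M (i, j) (i, j) * M (k, l) (k, l) = M (i, l) (i, l) * M (k, j) (k, j)) →
      M (0, 0) (0, 0) ^ (3 - 3) * ∏ i ∈ Finset.univ.filter (fun i : Fin 3 => 3 - 3 ≤ (i : ℕ)),
        M (i, i) (i, i) = 1 →
      ∃ e : ℂ, linSubst (Fin 3 × Fin 3) ℂ M F = e • F)
    {d d' : (Fin 3 × Fin 3) →₀ ℕ} (hd : d ∈ F.support) (hd' : d' ∈ F.support) :
    (∀ i : Fin 3, ∑ j : Fin 3, d (i, j) = ∑ j : Fin 3, d' (i, j)) ∧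
      (∀ j : Fin 3, ∑ i : Fin 3, d (i, j) = ∑ i : Fin 3, d' (i, j)) := by
  -- degrees
  have hdeg : ∀ {δ : (Fin 3 × Fin 3) →₀ ℕ}, δ ∈ F.support → ∑ i : Fin 3, ∑ j : Fin 3, δ (i, j) = k := by
    intro δ hδ
    have h := hF (mem_support_iff.1 hδ)
    rw [Finsupp.weight_apply, Finsupp.sum] at h
    simp only [Pi.one_apply, smul_eq_mul, mul_one] at h
    rw [← sum_prod_type_rowSums, ← h]
    exact (Finset.sum_subset (Finset.subset_univ _)
      (fun x _ hx => Finsupp.notMem_support_iff.1 hx)).symm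
  have two0 : (2 : ℂ) ≠ 0 := two_ne_zero
  have inv0 : (2⁻¹ : ℂ) ≠ 0 := inv_ne_zero two0
  -- row characters: rᵢ = 2 (others 1), c = (1, 1, 2⁻¹)
  have hT : ∀ i : Fin 3, ∑ j : Fin 3, d (i, j) + ∑ i : Fin 3, d' (i, 2) =
      ∑ j : Fin 3, d' (i, j) + ∑ i : Fin 3, d (i, 2) := by
    intro i
    have h := h0_33_character_eq hH (Function.update (fun _ => (1 : ℂ)) i 2) ![1, 1, 2⁻¹]
      (fun i' => by
        rcases eq_or_ne i' i with h | h
        · rw [h, Function.update_self]; exact two0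
        · rw [Function.update_of_ne h]; exact one_ne_zero)
      (fun j => by fin_cases j <;> simp)
      (by fin_cases i <;> simp)
      hd hd'
    fin_cases i <;>
      simp only [Fin.prod_univ_three, Function.update_apply, Fin.isValue, Fin.zero_eta, Fin.mk_one,
        Fin.reduceFinMk, if_true, Fin.reduceEq, if_false, one_pow, one_mul, mul_one,
        Matrix.cons_val_zero, Matrix.cons_val_one, Matrix.cons_val] at h ⊢ <;>
      exact two_pow_mul_inv_pow_inj h
  -- column characters: r = 1, cⱼ = 2 (j = 0, 1), c₂ = 2⁻¹
  have hS : ∀ j : Fin 3, j ≠ 2 → ∑ i : Fin 3, d (i, j) + ∑ i : Fin 3, d' (i, 2) =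
      ∑ i : Fin 3, d' (i, j) + ∑ i : Fin 3, d (i, 2) := by
    intro j hj
    have h := h0_33_character_eq hH (fun _ => (1 : ℂ)) (Function.update ![1, 1, 2⁻¹] j 2)
      (fun _ => one_ne_zero)
      (fun j' => by
        rcases eq_or_ne j' j with h | h
        · rw [h, Function.update_self]; exact two0
        · rw [Function.update_of_ne h]; fin_cases j' <;> simp)
      (by fin_cases j <;> simp at hj ⊢)
      hd hd'
    fin_cases j <;>
      simp only [Fin.prod_univ_three, Function.update_apply, Fin.isValue, Fin.zero_eta, Fin.mk_one,
        Fin.reduceFinMk, if_true, Fin.reduceEq, if_false, one_pow, one_mul, mul_one,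
        Matrix.cons_val_zero, Matrix.cons_val_one, Matrix.cons_val] at h hj ⊢ <;>
      first | exact absurd rfl hj | exact two_pow_mul_inv_pow_inj h
  have hk := hdeg hd
  have hk' := hdeg hd'
  simp only [Fin.sum_univ_three] at hk hk' hT hS ⊢
  have hT0 := hT 0
  have hT1 := hT 1
  have hT2 := hT 2
  have hS0 := hS 0 (by decide)
  have hS1 := hS 1 (by decide)
  refine ⟨fun i => ?_, fun j => ?_⟩
  · fin_cases i <;> simp only [Fin.isValue, Fin.zero_eta, Fin.mk_one, Fin.reduceFinMk] <;> omega
  · fin_cases j <;> simp only [Fin.isValue, Fin.zero_eta, Fin.mk_one, Fin.reduceFinMk] <;> omega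

end Summit.ValiantsHypothesis.Cruxes.ToricFixedPoints.Negative
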